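/-
Copyright (c) 2026 the pub-hodgecm-mathlib formalisation cell (harness21).  Prover seat hodgecm-mathlib-LH4-p13 (g7), req620 Track A «(D-RAM) FOUR-FRAME» squad, tier 0,
STAGE-1b PRE-SCOPING (heir LEAD F0P3a-plan (g20) T19-24 «allowed as scoping»): organ (L-lab) «THE LABEL LAW» of the rows `stub_rows_transvPlus ∕ stub_rows_transvMinus`
— brick (L-lab-3) «THE LABEL OF A SCALAR MULTIPLE OF THE REFERENCE NILPOTENT»: the end of the one-slot chain ★ p858717 → ★ p858774 → p858873 is a NORM-CLASS BIT.  2026-09-04.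
-/
import Summits.HodgeConjecture.HodgeConjecture.Theorems.F0P3cDyRamFrameEltOneSlotLabel   -- ★ p858774 (this seat, (L-lab-1)): `labelPlus_norm_smul_xPlus`, `valueSetMod_smul_xPlus_congr`; brings ★ (L-lab-0) `valueSetMod_xPlus`,
                                                                                        -- ★ `TableDiagWitnesses` (`not_labelPlus_smul_xPlus`, `pairing_smul_xPlus_mulVec`), ★ `WildQuadraticDatumRefSkewScalar` (`v_refSkewScalar`)
import Literature.NumberTheory.LocalFields.WildQuadraticDatumNormGradedSteps            -- ★ `v_eq_one_of_v_mul_map_eq_one`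
import HarnessLib

/-!
# Crux `H413`, line LH4 «(D-RAM) FOUR-FRAME», tier 0, STAGE-1b pre-scoping — (L-lab-3): the label of `e • X₊` is «`e` is a unit AND a norm»

Cell `hodgecm-mathlib` (D-0151), FLOOR 0, crux item H413 = `stmt-HodgeConjecture-24833`, route of record `HCCMUnconditional`; squad F0∕P3c∕LH4.  SCOPING INVENTORY for the
LEAD's PLAN-T1 v19 (L-lab) paragraph; THEOREMS ONLY (no `def`, no instance, no notation, no `sorry`, default heartbeats), ★-only imports, lane
`--supports stmt-HodgeConjecture-24833 --as helper`; pays NO row, states NO law.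

THE MATHEMATICS.  `σ` an involutive isometry of the valued field `K`, `|ϖ| = exp(−1)`, `|ϖ − σϖ| = |ϖ|^d`, `ℓ₀ = d % 2`, `t₊ = (ϖ − σϖ)·((ϖσϖ)^{⌊d∕2⌋})⁻¹` (`|t₊| = exp(−ℓ₀)`, ★
`v_refSkewScalar`), `X₊ = xPlus σ ϖ d = t₊·E₀₂`.  By ★ (L-lab-1)∕(L-lab-2) the label of an elliptic frame element `γ_b` at a one-slot-dominant vertex is `LabelPlus σ ϖ d m (e • X₊)`
for an explicit scalar `e` (`e·t₊ = (α−1)·N(f b i)⁻¹·N(s⋆)`).  This file decides that label.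
* §1 **`v_eq_one_of_labelPlus_smul_xPlus`** (`ℓ₀ < m`): `LabelPlus σ ϖ d m (e • X₊) → |e| = 1` — the value sets `e·t₊·N(𝒪) + ϖ^m𝒪` and `t₊·N(𝒪) + ϖ^m𝒪` have different reach
  unless `e` is a unit (test vectors `e₂` on both sides).  So only the layer `|(α−1)·N(s⋆)| = |N(f b i)|·|t₊|` of one-slot vertices can carry the label `+`; every other
  one-slot-dominant shell vertex is counted by `transvMinusFixCount`.
* §2 **`labelPlus_smul_xPlus_iff_exists_norm`**: over a complete sheet datum `IsRamifiedQuadraticDatum σ ϖ d t`, for a `σ`-FIXED unit `e` and the level of record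
  `m* = d % 2 + 2d − 1`: `LabelPlus σ ϖ d m* (e • X₊) ↔ ∃ z, z·σz = e` (★ `not_labelPlus_smul_xPlus` for the non-norm class, ★ `labelPlus_norm_smul_xPlus` for the norm class).
* §3 **`labelPlus_smul_xPlus_iff_exists_norm_of_congr`**: the same for ANY scalar `e` that is congruent to a `σ`-fixed unit `e′` at level `m*`
  (`|(ϖ^{m*})⁻¹·((e − e′)·t₊)| ≤ 1`; ★ `valueSetMod_smul_xPlus_congr`) — the form the one-slot chain delivers (`σe = e·σα ≠ e`; §4).
* §4 `map_oneSlot_scalar` : the one-slot scalar satisfies `σe = e·σα` (`N(f b i)`, `N(s⋆)` are `σ`-fixed, `t₊` is skew, `σ(α − 1) = −(α−1)·σα`) — it is `σ`-fixed only modulo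
  `|α − 1|`, which is the precision the directive must compare with `m* − ℓ₀ = 2d − 1` (the conductor window of ★ Serre V §3).
HONEST LABEL.  Count-neutral scoping brick; the three tier-0 rows stay OPEN; `HC_CM` is proved only modulo the 7 printed citations (2 remaining named inputs: hLiu418 =
`stmt-HodgeConjecture-24832`, h413 = `stmt-HodgeConjecture-24833`) until rung 0 closes.

## References
* [Rogawski1990] J. D. Rogawski, *Automorphic Representations of Unitary Groups in Three Variables*, Ann. of Math. Stud. 123 (1990), §4.9 Prop. 4.9.1 (a)(b) p. 55.
* [Serre1979] J.-P. Serre, *Local Fields*, GTM 67 (1979), Ch. V §3 Cor. 3 (norm classes of units in a ramified quadratic extension; the conductor).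
* [LanglandsShelstad1987] R. P. Langlands, D. Shelstad, *On the definition of transfer factors*, Math. Ann. 278 (1987), §3 (the κ-signs).
* [Kottwitz1986BaseChangeUnits] R. E. Kottwitz, *Base change for unit elements of Hecke algebras*, Compositio Math. 60 (1986), §1 pp. 240–241.
-/

set_option autoImplicit false

noncomputable section

namespace Summit.HodgeConjecture.HodgeConjecture.Cruxes.H413.F0P3cDyRamSmulXPlusLabel

open Literature.NumberTheory.Automorphic Literature.NumberTheory.Automorphic.HermitianLattice
open Literature.NumberTheory.Automorphic.UnitaryLatticeTree Literature.NumberTheory.Automorphic.UnitaryThreeFourFrame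
open Literature.NumberTheory.LocalFields.WildQuadraticDatum (v_refSkewScalar refSkewScalar_ne_zero v_eq_one_of_v_mul_map_eq_one)
open Summit.HodgeConjecture.HodgeConjecture.Cruxes.H413.F0P3cDyRamFourFramePieces
open Summit.HodgeConjecture.HodgeConjecture.Cruxes.H413.F0P3cDyRamFrameEltValueSet (valueSetMod_xPlus)
open Summit.HodgeConjecture.HodgeConjecture.Cruxes.H413.F0P3cDyRamFrameEltOneSlotLabel (labelPlus_norm_smul_xPlus valueSetMod_smul_xPlus_congr)
open Summit.HodgeConjecture.HodgeConjecture.Cruxes.H413.F0P3cDyRamTableDiagWitnesses (pairing_smul_xPlus_mulVec not_labelPlus_smul_xPlus)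
open scoped Matrix Valued
open WithZero

variable {K : Type} [Field K] [Valued K ℤᵐ⁰]

/-! ## §1  A labelled scalar multiple of `X₊` has a UNIT scalar -/

/-- The value set of `e • X₊` in the letter `a ↦ e·t₊·N(a)` (★ (L-lab-0) `valueSetMod_xPlus` rescaled; ★ `pairing_smul_xPlus_mulVec`). [cite: Rogawski1990, §4.9 Prop. 4.9.1 (b) p. 55] -/
theorem valueSetMod_smul_xPlus (σ : K →+* K) (ϖ : K) (d m : ℕ) (e : K) :
    valueSetMod σ ϖ m (e • xPlus σ ϖ d) =
      {z | ∃ a : K, Valued.v a ≤ 1 ∧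
        Valued.v ((ϖ ^ m)⁻¹ * (z - e * ((ϖ - σ ϖ) * ((ϖ * σ ϖ) ^ ((d - d % 2) / 2))⁻¹ * (a * σ a)))) ≤ 1} := by
  ext z
  simp only [valueSetMod, Set.mem_setOf_eq]
  constructor
  · rintro ⟨y, hy, hz⟩
    exact ⟨y 2, hy 2, by rw [pairing_smul_xPlus_mulVec] at hz; exact hz⟩
  · rintro ⟨a, ha, hz⟩
    refine ⟨![0, 0, a], fun i => ?_, ?_⟩
    · fin_cases i
      · simp
      · simp
      · simpa using ha
    · rw [pairing_smul_xPlus_mulVec]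
      simpa using hz

/-- **`LabelPlus (e • X₊) ⇒ |e| = 1`** (`σ` isometric, `|ϖ| = exp(−1)`, `|ϖ − σϖ| = |ϖ|^d`, `d % 2 < m`): if the `ϖ^m`-thickened value sets of `e·X₊` and `X₊` agree, then `t₊` (the value of
`X₊` at `e₂`) is `e·t₊·N(a)` up to `ϖ^m` for an integral `a`, forcing `|e| ≥ 1`, and `e·t₊` is `t₊·N(a′)` up to `ϖ^m`, forcing `|e| ≤ 1`.
[cite: Rogawski1990, §4.9 Prop. 4.9.1 (b) p. 55] [cite: Serre1979, Ch. V §3 Cor. 3] -/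
theorem v_eq_one_of_labelPlus_smul_xPlus {σ : K →+* K} (hvσ : ∀ a, Valued.v (σ a) = Valued.v a) {ϖ : K} (hϖ : Valued.v ϖ = exp (-1 : ℤ)) {d : ℕ}
    (hd : Valued.v (ϖ - σ ϖ) = Valued.v ϖ ^ d) {m : ℕ} (hm : d % 2 < m) {e : K} (hL : LabelPlus σ ϖ d m (e • xPlus σ ϖ d)) :
    Valued.v e = 1 := by
  have hϖm : Valued.v ((ϖ ^ m)⁻¹) = exp (m : ℤ) := by
    rw [map_inv₀, map_pow, hϖ, ← exp_nsmul, ← exp_neg]; congr 1; simp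
  -- reading `|(ϖ^m)⁻¹·x| ≤ 1` as `|x| ≤ exp(−m)`
  have hread : ∀ x : K, Valued.v ((ϖ ^ m)⁻¹ * x) ≤ 1 → Valued.v x ≤ exp (-(m : ℤ)) := by
    intro x hx
    rw [map_mul, hϖm] at hx
    have h2 : Valued.v x = exp (-(m : ℤ)) * (exp (m : ℤ) * Valued.v x) := by
      rw [← mul_assoc, ← exp_add]; simp
    rw [h2]
    exact mul_le_of_le_one_right' hx
  -- a norm of an integral element is integral
  have hN : ∀ a : K, Valued.v a ≤ 1 → Valued.v (a * σ a) ≤ 1 := fun a ha => by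
    rw [map_mul, hvσ]; exact mul_le_one' ha ha
  rw [LabelPlus, valueSetMod_smul_xPlus, valueSetMod_xPlus] at hL
  -- the reference scalar `t₊`
  set tp : K := (ϖ - σ ϖ) * ((ϖ * σ ϖ) ^ ((d - d % 2) / 2))⁻¹ with htpdef
  have ht : Valued.v tp = exp (-((d % 2 : ℕ) : ℤ)) := v_refSkewScalar hvσ hϖ hd
  -- Step 1: `t₊` is a value of `X₊` (`a = 1`), hence of `e • X₊`: `|t₊·(1 − e·N(a))| ≤ exp(−m)` ⇒ `|1 − e·N(a)| < 1` ⇒ `|e| ≥ 1`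
  have h1 : tp ∈ {z | ∃ a : K, Valued.v a ≤ 1 ∧ Valued.v ((ϖ ^ m)⁻¹ * (z - tp * (a * σ a))) ≤ 1} :=
    ⟨1, by rw [map_one], by rw [map_one, mul_one, mul_one, sub_self, mul_zero, map_zero]; exact zero_le_one⟩
  rw [← hL] at h1
  obtain ⟨a, ha, h1⟩ := h1
  have h1' : Valued.v (1 - e * (a * σ a)) < 1 := by
    have hx := hread _ h1
    have hfac : tp - e * (tp * (a * σ a)) = tp * (1 - e * (a * σ a)) := by ring
    rw [hfac, map_mul, ht] at hx
    rcases eq_or_ne (Valued.v (1 - e * (a * σ a))) 0 with h0 | h0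
    · rw [h0]; exact zero_lt_one
    · rw [← exp_log h0] at hx ⊢
      rw [← exp_add, exp_le_exp] at hx
      rw [← exp_zero, exp_lt_exp]
      omega
  have hge : 1 ≤ Valued.v e := by
    -- `|1 − x| < 1 ⇒ |x| = 1`, `x = e·N(a)` with `|N(a)| ≤ 1`
    have heq : Valued.v (e * (a * σ a)) = 1 := by
      have h := Valuation.map_one_sub_of_lt _ h1'
      rwa [sub_sub_cancel] at h
    rw [map_mul] at heq
    have he0 : Valued.v e ≠ 0 := fun h0 => by rw [h0, zero_mul] at heq; exact zero_ne_one heq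
    have hN0 : Valued.v (a * σ a) ≠ 0 := fun h0 => by rw [h0, mul_zero] at heq; exact zero_ne_one heq
    have hNle := hN a ha
    rw [← exp_log he0, ← exp_log hN0, ← exp_add, ← exp_zero, exp_inj] at heq
    rw [← exp_log hN0, ← exp_zero, exp_le_exp] at hNle
    rw [← exp_log he0, ← exp_zero, exp_le_exp]
    omega
  -- Step 2: `e·t₊` is a value of `e • X₊` (`a = 1`), hence of `X₊`: `|t₊·(e − N(a′))| ≤ exp(−m)`; if `|e| > 1` then `|e − N(a′)| = |e|`, absurd
  have h2 : e * tp ∈ {z | ∃ a : K, Valued.v a ≤ 1 ∧ Valued.v ((ϖ ^ m)⁻¹ * (z - e * (tp * (a * σ a)))) ≤ 1} :=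
    ⟨1, by rw [map_one], by rw [map_one, mul_one, mul_one, sub_self, mul_zero, map_zero]; exact zero_le_one⟩
  rw [hL] at h2
  obtain ⟨a', ha', h2⟩ := h2
  have hle : Valued.v e ≤ 1 := by
    by_contra hgt
    rw [not_le] at hgt
    have hx := hread _ h2
    have hfac : e * tp - tp * (a' * σ a') = tp * (e - a' * σ a') := by ring
    rw [hfac, map_mul, ht, Valuation.map_sub_eq_of_lt_left _ (lt_of_le_of_lt (hN a' ha') hgt)] at hx
    have he0 : Valued.v e ≠ 0 := ne_of_gt (lt_trans zero_lt_one hgt)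
    rw [← exp_log he0] at hx hgt
    rw [← exp_add, exp_le_exp] at hx
    rw [← exp_zero, exp_lt_exp] at hgt
    omega
  exact le_antisymm hle hge

/-! ## §2  For a `σ`-fixed unit scalar the label is the norm class -/

/-- **THE LABEL OF `e • X₊` IS THE NORM CLASS OF `e`** (complete sheet datum `IsRamifiedQuadraticDatum σ ϖ d t`, `e` a `σ`-FIXED UNIT, level of record `m* = d % 2 + 2d − 1`):
`LabelPlus σ ϖ d m* (e • xPlus σ ϖ d) ↔ ∃ z, z·σz = e` — ★ `not_labelPlus_smul_xPlus` (non-norm class ⇒ no label) and ★ `labelPlus_norm_smul_xPlus` (norm class ⇒ label).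
[cite: Serre1979, Ch. V §3 Cor. 3] [cite: Rogawski1990, §4.9 Prop. 4.9.1 (b) p. 55] [cite: LanglandsShelstad1987, §3] -/
theorem labelPlus_smul_xPlus_iff_exists_norm [IsAdicComplete 𝓂[K] 𝒪[K]] {σ : K →+* K} {ϖ : K} {d t : ℕ} (hD : IsRamifiedQuadraticDatum σ ϖ d t)
    {e : K} (hσe : σ e = e) (he1 : Valued.v e = 1) :
    LabelPlus σ ϖ d (d % 2 + 2 * d - 1) (e • xPlus σ ϖ d) ↔ ∃ z : K, z * σ z = e := by
  have hvσ : ∀ a, Valued.v (σ a) = Valued.v a := hD.2.1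
  constructor
  · intro hL
    by_contra hne
    exact not_labelPlus_smul_xPlus hD hσe (fun z hz => hne ⟨z, hz⟩) hL
  · rintro ⟨z, hz⟩
    have hz1 : Valued.v z = 1 := v_eq_one_of_v_mul_map_eq_one hvσ (by rw [hz, he1])
    rw [← hz]
    exact labelPlus_norm_smul_xPlus σ ϖ d _ hz1

/-! ## §3  Any scalar congruent to a `σ`-fixed unit at level `m*` -/

/-- **THE LABEL OF `e • X₊` FOR A SCALAR CONGRUENT TO A `σ`-FIXED UNIT**: if `e′` is a `σ`-fixed unit with `|(ϖ^{m*})⁻¹·((e − e′)·t₊)| ≤ 1` (`m* = d % 2 + 2d − 1`), then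
`LabelPlus σ ϖ d m* (e • xPlus σ ϖ d) ↔ ∃ z, z·σz = e′` (★ `valueSetMod_smul_xPlus_congr` + §2) — the form in which the one-slot chain (★ p858774 §3, ★ (L-lab-2) §3) hands its
non-fixed scalar `e` (`σe = e·σα`, §4) to the norm-class test. [cite: Serre1979, Ch. V §3 Cor. 3] [cite: LanglandsShelstad1987, §3] -/
theorem labelPlus_smul_xPlus_iff_exists_norm_of_congr [IsAdicComplete 𝓂[K] 𝒪[K]] {σ : K →+* K} {ϖ : K} {d t : ℕ} (hD : IsRamifiedQuadraticDatum σ ϖ d t)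
    {e e' : K} (hσe' : σ e' = e') (he'1 : Valued.v e' = 1)
    (hee : Valued.v ((ϖ ^ (d % 2 + 2 * d - 1))⁻¹ * ((e - e') * ((ϖ - σ ϖ) * ((ϖ * σ ϖ) ^ ((d - d % 2) / 2))⁻¹))) ≤ 1) :
    LabelPlus σ ϖ d (d % 2 + 2 * d - 1) (e • xPlus σ ϖ d) ↔ ∃ z : K, z * σ z = e' := by
  have hvσ : ∀ a, Valued.v (σ a) = Valued.v a := hD.2.1
  rw [LabelPlus, valueSetMod_smul_xPlus_congr hvσ ϖ d (d % 2 + 2 * d - 1) hee, ← LabelPlus]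
  exact labelPlus_smul_xPlus_iff_exists_norm hD hσe' he'1

/-! ## §4  The one-slot scalar is `σ`-fixed only modulo `|α − 1|` -/

omit [Valued K ℤᵐ⁰] in
/-- **`σe = e·σα` FOR THE ONE-SLOT SCALAR** `e·t₊ = (α − 1)·N⁻¹·(s·σs)` (`σ` an involution, `ασα = 1`, `N` `σ`-fixed — e.g. `N = ⟨f b i, f b i⟩` — `t₊` skew and non-zero):
applying `σ` to the defining equation gives `σe·(−t₊) = (σα − 1)·N⁻¹·(s·σs) = −σα·(α − 1)·N⁻¹·(s·σs) = −σα·e·t₊`.  So `|σe − e| = |e|·|α − 1|`: the scalar is `σ`-fixed exactly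
to the depth of `α − 1`, the number the directive compares with the conductor window `m* − ℓ₀ = 2d − 1` before §3 applies. [cite: Serre1979, Ch. V §3 Cor. 3] -/
theorem map_oneSlot_scalar {σ : K →+* K} (hσσ : ∀ a, σ (σ a) = a) {α N s tp e : K} (hα : α * σ α = 1) (hN : σ N = N) (htp : σ tp = -tp)
    (htp0 : tp ≠ 0) (he : e * tp = (α - 1) * N⁻¹ * (s * σ s)) : σ e = e * σ α := by
  have h1 := congrArg σ he
  rw [map_mul, htp, map_mul, map_mul, map_sub, map_one, map_inv₀, hN, map_mul, hσσ] at h1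
  -- `σe·(−t₊) = (σα − 1)·N⁻¹·(σs·s)` and `σα − 1 = −σα·(α − 1)` (`ασα = 1`)
  have h2 : σ α - 1 = -(σ α * (α - 1)) := by linear_combination hα
  rw [h2] at h1
  apply mul_right_cancel₀ htp0
  have h3 : σ e * tp = σ α * ((α - 1) * N⁻¹ * (s * σ s)) := by linear_combination -h1
  rw [h3, ← he]; ring

end Summit.HodgeConjecture.HodgeConjecture.Cruxes.H413.F0P3cDyRamSmulXPlusLabel

end
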